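import Summits.NavierStokesRegularity.FluidComputer.ClayBlowupSwirlBound
import Summits.NavierStokesRegularity.FluidComputer.ClayBlowupDissipationConcentration
import Summits.NavierStokesRegularity.FluidComputer.ClayBlowupL3Concentration
import Summits.NavierStokesRegularity.FluidComputer.ClayBlowupConcentration
import Summits.NavierStokesRegularity.FluidComputer.ClayBlowupSerrin
import Summits.NavierStokesRegularity.FluidComputer.ClayBlowupEnstrophyDivergence
import Summits.NavierStokesRegularity.FluidComputer.ClayBlowupEnergyContinuity
import HarnessLib

/-!
# THE PORTRAIT OF A CLAY BLOW-UP: every kernel necessary condition on the E–C certificate type, in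
# ONE theorem (general / axisymmetric / unforced)

Cell `ns-blowup`, seat `ns-blowup-ecbridge-2` (g8; the E–C endpoint theory seat). LABEL: E–C typing
(KERNEL — no named fact; every conjunct is a tree theorem of the ecbridge-2 lineage g4–g8 or of the
lean lineage). WHAT THIS IS NOT: not Navier–Stokes evidence — a conjunction of necessary conditions on
the TYPE `ClayBlowup ν` (Leray's époque d'irrégularité for a Clay datum WITH a Clay force: a classical
forced solution on `[0, T)` with no finite-energy classical continuation past `T`). No inhabitant is
claimed; by `navierStokesBreakdownR3_iff_exists_nonempty_clayBlowup` (g5) an inhabitant at one `ν > 0`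
is exactly a certificate of Fefferman's (C), and an UNFORCED inhabitant exactly a counterexample to (A).
Companion memo: `run/shared/lean/pub/ns-blowup/ecbridge2/ECBRIDGE-2-MEMO-7.md`.

## Why one theorem

Construction lanes (tower, AGL, FC, profile) and the refuters' KILLSHEET cite the E–C rows one by one
(K103 bundled fifteen of them by hand). `ClayBlowup.portrait` is the by-name checklist a design must
visibly pass: ANY `X : ClayBlowup ν`, `ν > 0`, satisfies ALL of

1. ENERGY — one bound `∫|u(t)|² ≤ E < ∞` on `[0, T)` (`energy_le`);
2. DISSIPATION — `∫₀ᵀ ∫ |∇u|² < ∞` (`lintegral_dissipation_lt_top`);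
3. ENERGY CONTINUITY — `½∫|u(t)|²` has a limit as `t ↑ T` (`tendsto_kineticEnergy`);
4. `L^∞` BLOW-UP — `u` is unbounded on `[0, T) × ℝ³` (`velocity_unbounded`);
5. ENSTROPHY BLOW-UP — `∫|∇u(t)|² → ∞` as `t ↑ T` (`tendsto_enstrophy_top`);
6. SOHR CORNER — `∫₀ᵀ ‖u(t)‖_{L^r}^{2/(1−3/r)} dt = ∞` for EVERY `3 < r ≤ ∞` (`lintegral_serrin_eq_top`);
7. TYPE-II FLOOR — no rate `‖u(t)‖_∞ ≤ C (T−t)^{−γ}` with `γ < 1/2` (`not_subTypeI`);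
8. FAR FIELD — `u` is bounded on `(T/2, T) × {|x| > R}` (`exists_farField_bound`);
9. SINGULAR SLICE — `S_T = {x₀ | ¬ IsBackwardBoundedAt u T x₀}` is compact, nonempty, `ℋ¹`-null
   (`singularSlice_compact_nonempty_hausdorffOne_null`);
10. CKN CONCENTRATION — `∬_{Q_r(T,x₀)} |u|³ + |p_N + Φ_f|^{3/2} > ε³ r²` at every `x₀ ∈ S_T`, all
    `r ≤ r₁` (`ckn_concentration`);
11. DISSIPATION CONCENTRATION — `limsup_{r→0} r⁻¹ ∬_{Q_r(T,x₀)} |∇u|² > ε` at every `x₀ ∈ S_T`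
    (`dissipation_concentration`, g8);
12. MAXIMALITY — no classical continuation past `T` whatsoever (`not_hasSmoothExtensionPast`).

`ClayBlowup.axisymmetric_portrait` adds, for axisymmetric datum and force: `S_T ⊆ axis`, the swirl
`r u_θ` bounded on `[0, T) × ℝ³` (g8), `u` bounded outside every tube around the axis on `[δ, T)` and
unbounded inside every tube (g7). `ClayBlowup.unforced_portrait` adds, for the ¬(A) witnesses
(`f = 0`): a global Leray–Hopf solution equal to `u` on `[0, T)`, and `‖u(t)‖_{L³} → ∞` along a sequence
`t ↑ T` (ESS); with an axisymmetric datum moreover ¬Type I, `sup r|u| = ∞`, `sup r|ū| = ∞` with `r u_θ`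
bounded (g7/g8: `axisymmetric_swirl_portrait_of_force_eq_zero`, `ClayBlowupSwirlBound.lean`, is the
unforced axisymmetric portrait and is not restated here). `DesignedBlowup` twins by `toClayBlowup`.

References: C. L. Fefferman, Clay problem description, (A), (C) [cite: FeffermanClay2006, (C)]; J. Leray,
Acta Math. 63 (1934), §32 and (3.16) [cite: Leray1934, §32]; L. Caffarelli, R. Kohn, L. Nirenberg, CPAM 35
(1982), Prop. 1–2, Theorem B [cite: CaffarelliKohnNirenberg1982, Theorem B]; L. Escauriaza, G. Seregin,
V. Šverák, Russ. Math. Surveys 58 (2003), Thms. 1.3–1.4 [cite: EscauriazaSereginSverak2003, Thm. 1.4];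
G. Koch, N. Nadirashvili, G. Seregin, V. Šverák, Acta Math. 203 (2009), Thms. 6.1–6.2
[cite: KochNadirashviliSereginSverak2009, Thms 6.1–6.2]; H. Sohr, Birkhäuser 2001, Thm. V.1.8.1
[cite: Sohr2001, Thm. V.1.8.1].
-/

noncomputable section

namespace Summit.NavierStokesRegularity.FluidComputer

open Set MeasureTheory Filter Topology Function Metric
open scoped ENNReal ContDiff NNReal
open Literature.Analysis.FluidPDE
open Summit.NavierStokesRegularity.NavierStokesRegularity

namespace ClayBlowup

variable {ν : ℝ} (X : ClayBlowup ν)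

/-- **THE PORTRAIT OF A CLAY BLOW-UP** (`ν > 0`; every Clay blow-up, the force being the Clay force of
the type; no named fact). Twelve kernel necessary conditions in one conjunction — see the module
docstring for the list (energy, dissipation, energy continuity, `L^∞` blow-up, enstrophy blow-up, Sohr
corner for every `3 < r ≤ ∞`, Type-II floor, far-field bound, compact nonempty `ℋ¹`-null singular slice,
CKN concentration, dissipation concentration, maximality). [cite: FeffermanClay2006, (C)]
[cite: CaffarelliKohnNirenberg1982, Theorem B] [cite: Leray1934, §32] [cite: Sohr2001, Thm. V.1.8.1] -/
theorem portrait (hν : 0 < ν) :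
    -- 1. one energy bound on the lifespan
    (∃ E : ℝ≥0∞, E < ⊤ ∧ ∀ t ∈ Ico 0 X.T, ∫⁻ x, ‖X.u t x‖ₑ ^ 2 ≤ E) ∧
    -- 2. integrable dissipation through the lifespan
    (∫⁻ t in Ioo 0 X.T, ∫⁻ x, ENNReal.ofReal (frobeniusNormSq (fderiv ℝ (X.u t) x)) < ⊤) ∧
    -- 3. the kinetic energy has a limit at `T`
    (∃ e : ℝ, Tendsto (fun t => VectorCalculus.kineticEnergy (X.u t)) (𝓝[<] X.T) (𝓝 e)) ∧
    -- 4. the velocity is unbounded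
    (¬ ∃ M : ℝ, ∀ t ∈ Ico 0 X.T, ∀ x, ‖X.u t x‖ ≤ M) ∧
    -- 5. the enstrophy tends to `∞`
    Tendsto (fun t => ∫⁻ x, ENNReal.ofReal (frobeniusNormSq (fderiv ℝ (X.u t) x)))
      (𝓝[<] X.T) (𝓝 ⊤) ∧
    -- 6. the velocity leaves every Ladyzhenskaya–Prodi–Serrin class
    (∀ r : ℝ≥0∞, 3 < r →
      ∫⁻ t in Ioo 0 X.T,
        ENNReal.ofReal ((eLpNorm (X.u t) r volume).toReal ^ (2 / (1 - (3 / r).toReal))) = ⊤) ∧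
    -- 7. no sub-Type-I rate
    (∀ C γ : ℝ, 0 ≤ C → γ < 1 / 2 →
      ¬ ∀ t ∈ Ioo 0 X.T, eLpNorm (X.u t) ⊤ volume ≤ ENNReal.ofReal (C * (X.T - t) ^ (-γ))) ∧
    -- 8. far-field regularity
    (∃ R M : ℝ, ∀ t ∈ Ioo (X.T / 2) X.T, ∀ x : EuclideanSpace ℝ (Fin 3), R < ‖x‖ → ‖X.u t x‖ ≤ M) ∧
    -- 9. the singular slice is compact, nonempty and `ℋ¹`-null
    (IsCompact {x₀ : EuclideanSpace ℝ (Fin 3) | ¬ IsBackwardBoundedAt X.u X.T x₀} ∧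
      {x₀ : EuclideanSpace ℝ (Fin 3) | ¬ IsBackwardBoundedAt X.u X.T x₀}.Nonempty ∧
        μH[1] {x₀ : EuclideanSpace ℝ (Fin 3) | ¬ IsBackwardBoundedAt X.u X.T x₀} = 0) ∧
    -- 10. CKN concentration at every singular point
    (∃ ε r₁ : ℝ, 0 < ε ∧ 0 < r₁ ∧ ∀ x₀ : EuclideanSpace ℝ (Fin 3), ¬ IsBackwardBoundedAt X.u X.T x₀ →
      ∀ r : ℝ, 0 < r → r ≤ r₁ →
        ENNReal.ofReal (ε ^ 3 * r ^ 2) <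
          ∫⁻ z in parabolicCylinder r ((X.T : ℝ), x₀),
            (‖X.u z.1 z.2‖ₑ ^ (3 : ℕ) +
              ‖normalisedPressure (X.u z.1) z.2 + forcePotential (X.f z.1) z.2‖ₑ ^ (3 / 2 : ℝ))) ∧
    -- 11. dissipation concentration at every singular point
    (∃ ε : ℝ, 0 < ε ∧ ∀ x₀ : EuclideanSpace ℝ (Fin 3), ¬ IsBackwardBoundedAt X.u X.T x₀ →
      ENNReal.ofReal ε <
        limsup (fun r : ℝ => (ENNReal.ofReal r)⁻¹ *
          ∫⁻ w in parabolicCylinder r ((X.T : ℝ), x₀),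
            ENNReal.ofReal (frobeniusNormSq (fderiv ℝ (X.u w.1) w.2))) (𝓝[>] (0 : ℝ))) ∧
    -- 12. no classical continuation past `T` at all
    ¬ HasSmoothExtensionPast ν X.f X.u X.T :=
  ⟨X.energy_le hν, X.lintegral_dissipation_lt_top hν, X.tendsto_kineticEnergy hν,
    X.velocity_unbounded hν, X.tendsto_enstrophy_top hν,
    fun _ hr => X.lintegral_serrin_eq_top hν hr,
    fun _ _ hC hγ hrate => X.not_subTypeI hν hC hγ hrate,
    X.exists_farField_bound hν, X.singularSlice_compact_nonempty_hausdorffOne_null hν,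
    X.ckn_concentration hν, X.dissipation_concentration hν, X.not_hasSmoothExtensionPast hν⟩

/-- **THE AXISYMMETRIC PORTRAIT** (`ν > 0`, axisymmetric datum, force axisymmetric on `[0, T)`; no named
fact): on top of `portrait`, (i) every singular point of the final slice lies ON THE AXIS; (ii) the
swirl `r u_θ` is bounded on `[0, T) × ℝ³` (g8); (iii) for every `ρ₀, δ > 0`, `u` is bounded on
`[δ, T) × {r ≥ ρ₀}`; (iv) for every `ρ₀ > 0`, `u` is unbounded inside the tube `{r < ρ₀}` on every
`(t₀, T)`. [cite: CaffarelliKohnNirenberg1982, Theorem B] [cite: KochNadirashviliSereginSverak2009, §1 (1.9)] -/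
theorem axisymmetric_portrait (hν : 0 < ν) (h0A : IsAxisymmetric (X.u 0))
    (hfA : ∀ t ∈ Ico 0 X.T, IsAxisymmetric (X.f t)) :
    {x₀ : EuclideanSpace ℝ (Fin 3) | ¬ IsBackwardBoundedAt X.u X.T x₀} ⊆
        {x : EuclideanSpace ℝ (Fin 3) | cylRadius x = 0} ∧
      (∃ C : ℝ, 0 ≤ C ∧ ∀ t ∈ Ico 0 X.T, ∀ x, |swirl (X.u t) x| ≤ C) ∧
      (∀ ρ₀ : ℝ, 0 < ρ₀ → ∀ δ : ℝ, 0 < δ →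
        ∃ M : ℝ, ∀ t ∈ Ico δ X.T, ∀ x : EuclideanSpace ℝ (Fin 3), ρ₀ ≤ cylRadius x → ‖X.u t x‖ ≤ M) ∧
      ∀ ρ₀ : ℝ, 0 < ρ₀ → ∀ M t₀ : ℝ, t₀ < X.T →
        ∃ t ∈ Ioo t₀ X.T, ∃ x : EuclideanSpace ℝ (Fin 3), cylRadius x < ρ₀ ∧ M < ‖X.u t x‖ :=
  ⟨X.singularSlice_subset_axis hν h0A hfA, X.swirl_bounded hν h0A hfA,
    fun _ hρ₀ _ hδ => X.exists_bound_off_axis_tube hν h0A hfA hρ₀ hδ,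
    fun _ hρ₀ M _ ht₀ => X.unbounded_in_axis_tube hν h0A hfA hρ₀ M ht₀⟩

/-- **THE UNFORCED PORTRAIT** — the ¬(A) witnesses (`ν > 0`, `f = 0`; no named fact): on top of
`portrait`, (i) a GLOBAL Leray–Hopf weak solution from `u(0)` coincides with `u` on `[0, T)` (the blow-up
continues as a weak solution); (ii) `‖u(t)‖_{L³(ℝ³)}` exceeds every bound at times `t ↑ T`
(Escauriaza–Seregin–Šverák); (iii) at every singular point and every scale the local `L^∞_t L³_x` norm is
infinite. [cite: EscauriazaSereginSverak2003, Thm. 1.4] [cite: Leray1934, §32] -/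
theorem unforced_portrait (hν : 0 < ν) (hf : X.f = 0) :
    (∃ v : ℝ → EuclideanSpace ℝ (Fin 3) → EuclideanSpace ℝ (Fin 3),
        (∀ t ∈ Ico 0 X.T, v t = X.u t) ∧ (∀ t < X.T, v t = X.u t) ∧
          IsGlobalLerayHopf ν 0 (X.u 0) v) ∧
      (∀ M : ℝ≥0, ∀ t₀ : ℝ, t₀ < X.T →
        ∃ t ∈ Ioo t₀ X.T, 0 ≤ t ∧ (M : ℝ≥0∞) < eLpNorm (X.u t) 3 volume) ∧
      ∀ x₀ : EuclideanSpace ℝ (Fin 3), ¬ IsBackwardBoundedAt X.u X.T x₀ →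
        ∀ r : ℝ, 0 < r → r ^ 2 ≤ X.T → ∀ C : ℝ≥0,
          ¬ ∀ᵐ t ∂(volume.restrict (Ioo (X.T - r ^ 2) X.T)),
            ∫⁻ x in ball x₀ r, ‖X.u t x‖ₑ ^ 3 ≤ C :=
  ⟨X.exists_lerayHopf_completion hν hf, fun M _ ht₀ => X.limsup_eLpNorm_three_eq_top hν hf M ht₀,
    fun _ hx₀ _ hr hrT C => X.L3_concentration hν hf hx₀ hr hrT C⟩

end ClayBlowup

/-! ## The strong type -/

namespace DesignedBlowup

variable {ν : ℝ} (D : DesignedBlowup ν)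

/-- **The portrait of a designed blow-up** (`ν > 0`): the twelve kernel necessary conditions of
`ClayBlowup.portrait`, through `toClayBlowup`. [cite: FeffermanClay2006, (C)] -/
theorem portrait (hν : 0 < ν) :
    (∃ E : ℝ≥0∞, E < ⊤ ∧ ∀ t ∈ Ico 0 D.T, ∫⁻ x, ‖D.u t x‖ₑ ^ 2 ≤ E) ∧
    (∫⁻ t in Ioo 0 D.T, ∫⁻ x, ENNReal.ofReal (frobeniusNormSq (fderiv ℝ (D.u t) x)) < ⊤) ∧
    (∃ e : ℝ, Tendsto (fun t => VectorCalculus.kineticEnergy (D.u t)) (𝓝[<] D.T) (𝓝 e)) ∧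
    (¬ ∃ M : ℝ, ∀ t ∈ Ico 0 D.T, ∀ x, ‖D.u t x‖ ≤ M) ∧
    Tendsto (fun t => ∫⁻ x, ENNReal.ofReal (frobeniusNormSq (fderiv ℝ (D.u t) x)))
      (𝓝[<] D.T) (𝓝 ⊤) ∧
    (∀ r : ℝ≥0∞, 3 < r →
      ∫⁻ t in Ioo 0 D.T,
        ENNReal.ofReal ((eLpNorm (D.u t) r volume).toReal ^ (2 / (1 - (3 / r).toReal))) = ⊤) ∧
    (∀ C γ : ℝ, 0 ≤ C → γ < 1 / 2 →
      ¬ ∀ t ∈ Ioo 0 D.T, eLpNorm (D.u t) ⊤ volume ≤ ENNReal.ofReal (C * (D.T - t) ^ (-γ))) ∧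
    (∃ R M : ℝ, ∀ t ∈ Ioo (D.T / 2) D.T, ∀ x : EuclideanSpace ℝ (Fin 3), R < ‖x‖ → ‖D.u t x‖ ≤ M) ∧
    (IsCompact {x₀ : EuclideanSpace ℝ (Fin 3) | ¬ IsBackwardBoundedAt D.u D.T x₀} ∧
      {x₀ : EuclideanSpace ℝ (Fin 3) | ¬ IsBackwardBoundedAt D.u D.T x₀}.Nonempty ∧
        μH[1] {x₀ : EuclideanSpace ℝ (Fin 3) | ¬ IsBackwardBoundedAt D.u D.T x₀} = 0) ∧
    (∃ ε r₁ : ℝ, 0 < ε ∧ 0 < r₁ ∧ ∀ x₀ : EuclideanSpace ℝ (Fin 3), ¬ IsBackwardBoundedAt D.u D.T x₀ →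
      ∀ r : ℝ, 0 < r → r ≤ r₁ →
        ENNReal.ofReal (ε ^ 3 * r ^ 2) <
          ∫⁻ z in parabolicCylinder r ((D.T : ℝ), x₀),
            (‖D.u z.1 z.2‖ₑ ^ (3 : ℕ) +
              ‖normalisedPressure (D.u z.1) z.2 + forcePotential (D.f z.1) z.2‖ₑ ^ (3 / 2 : ℝ))) ∧
    (∃ ε : ℝ, 0 < ε ∧ ∀ x₀ : EuclideanSpace ℝ (Fin 3), ¬ IsBackwardBoundedAt D.u D.T x₀ →
      ENNReal.ofReal ε <
        limsup (fun r : ℝ => (ENNReal.ofReal r)⁻¹ *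
          ∫⁻ w in parabolicCylinder r ((D.T : ℝ), x₀),
            ENNReal.ofReal (frobeniusNormSq (fderiv ℝ (D.u w.1) w.2))) (𝓝[>] (0 : ℝ))) ∧
    ¬ HasSmoothExtensionPast ν D.f D.u D.T :=
  D.toClayBlowup.portrait hν

end DesignedBlowup

/-! ## The (C)-reading -/

/-- **WHAT ANY CERTIFICATE OF FEFFERMAN'S (C) LOOKS LIKE**: if `NavierStokesBreakdownR3` holds then at
EVERY viscosity `ν > 0` there is a Clay blow-up, and every Clay blow-up passes the twelve-row portrait
`ClayBlowup.portrait`. (The existence half is g5's `forall_nonempty_clayBlowup_of_breakdownR3`; nothing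
here asserts (C).) [cite: FeffermanClay2006, (C)] -/
theorem clayBlowup_portrait_of_navierStokesBreakdownR3
    (hC : Summit.NavierStokesRegularity.NavierStokesRegularity.NavierStokesBreakdownR3) {ν : ℝ}
    (hν : 0 < ν) :
    ∃ X : ClayBlowup ν,
      (¬ ∃ M : ℝ, ∀ t ∈ Ico 0 X.T, ∀ x, ‖X.u t x‖ ≤ M) ∧
        (IsCompact {x₀ : EuclideanSpace ℝ (Fin 3) | ¬ IsBackwardBoundedAt X.u X.T x₀} ∧
          {x₀ : EuclideanSpace ℝ (Fin 3) | ¬ IsBackwardBoundedAt X.u X.T x₀}.Nonempty ∧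
            μH[1] {x₀ : EuclideanSpace ℝ (Fin 3) | ¬ IsBackwardBoundedAt X.u X.T x₀} = 0) ∧
        ¬ HasSmoothExtensionPast ν X.f X.u X.T := by
  obtain ⟨X⟩ := forall_nonempty_clayBlowup_of_breakdownR3 hC ν hν
  have h := X.portrait hν
  exact ⟨X, h.2.2.2.1, h.2.2.2.2.2.2.2.2.1, h.2.2.2.2.2.2.2.2.2.2.2⟩

end Summit.NavierStokesRegularity.FluidComputer

end
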